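import Mathlib
import Summits.SmoothPoincare4.SmoothPoincare4.Theorems.CylinderEntropySliceIsolationCertArith
import Summits.SmoothPoincare4.SmoothPoincare4.Theorems.CylinderEntropySliceIsolationCertZonal
import Summits.SmoothPoincare4.SmoothPoincare4.Theorems.CylinderEntropySliceIsolationCertEnvelope
import Literature.Geometry.Riemannian.SphericalZonalSharpTail
import HarnessLib

/-!
# The certificate checker of the conformal kernel domination (stubs `stub_certMidA/B/C`), I: the checker

Cert infrastructure 4/4 for the line `conformal-kernel-domination` of the crux
`Summit.SmoothPoincare4.SmoothPoincare4.Theses.CylinderEntropy.SliceIsolation` (crux item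
stmt-SmoothPoincare4-7632).  The registered mid-scale stubs ask, for every normalised scale `T` in a
decade, for finitely many on-axis zonal atoms `w_j · zonal(τ_j, s) · e^{-(u-σ_j)²/(4τ_j)}` plus an area
atom `c`, of total mass `≤ 147/100`, dominating the pulled-back kernel
`pulled(T,u,s) = (8π²/3)((4πT)²)⁻¹ e^{4u} e^{-(e^{2u} - 2e^u s + 1)/(4T)}` for all `u ∈ ℝ`, `s ∈ [-1,1]`.

This file (I of III) DEFINES the COMPUTABLE checker `Cert.checkCover` over `ℚ` for a list of `T`-cells, each
carrying such a certificate (atoms at `τ_j = -log(q_j)/2`, `q_j ∈ ℚ`); files II (`…CertCheckAtoms`) and III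
(`…CertCheck`) prove it SOUND (`Cert.certificates_of_checkCover`): if the checker accepts, the registered
inequality holds for every real `T` of the covered range.  Mechanism of the check, per cell `[T₁, T₂]`:
* atoms are validated (`0 < q < 1`, `0 ≤ w`, a certified `0 < tlo ≤ τ` via `q ≤ expLo(-2 tlo)`, the
  geometric-tail ratio `32 q^{⌊(K+4)/2⌋} < 1` in series mode);
* outside `[uMin, uMax]` the kernel is below the area atom (`Cert.pulled_le_of_u_le`,
  `Cert.pulled_le_of_le_u` of `…CertEnvelope`);
* on `[uMin, uMax] × [-1, 1]` an adaptive dyadic bisection compares, box by box, an UPPER bound of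
  `sup_{T ∈ cell, (u,s) ∈ box} pulled` (exact `T`-envelope `Cert.helper_certTsup`, `Q`-bound
  `Cert.Q_lower`, `exp` enclosures of `…CertArith`) with a LOWER bound of the certificate (monotonicity
  of `zonal` in `s` through a precomputed table of certified lower bounds — series partial sums with
  geometric tail `Cert.zonalLoSeriesR_le_zonal_of_le` or Hamilton's pole minorant
  `Cert.zonal_pole_gauss_le` — and the Gaussian factor at the far endpoint, `Cert.exp_quad_lower`).
The data files of the decade stubs then consist of certificate literals and one `native_decide` each
(proposed `--computational`).  No named facts; the only analytic inputs are the proved tree lemmas above.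
-/

-- the registered namespace `Summit.SmoothPoincare4.SmoothPoincare4.Theorems…` repeats a component
set_option linter.dupNamespace false

namespace Summit.SmoothPoincare4.SmoothPoincare4.Theorems.CylinderEntropySliceIsolation

open Literature.Geometry.Riemannian.SphericalCylinderEntropy
  Literature.Geometry.Riemannian.SphericalZonalKernelSeries

namespace Cert

/-! ## Data -/

/-- An on-axis zonal atom `w · zonal(τ, s) · e^{-(u-σ)²/(4τ)}` at `τ = -log(q)/2`, with a claimed lower
bound `tlo` of `τ`, a truncation order `K` and the minorant mode (`1`: rational partial sums with the crude
geometric tail `32^k`; `2`: the same with the sharp tail of `SphericalZonalSharpTail`; otherwise Hamilton's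
pole minorant). [folklore] -/
structure Atom where
  /-- `q = e^{-2τ} ∈ ℚ ∩ (0, 1)` -/
  q : ℚ
  /-- claimed lower bound of `τ` (validated by the checker) -/
  tlo : ℚ
  /-- centre height `σ` -/
  σ : ℚ
  /-- weight `w ≥ 0` -/
  w : ℚ
  /-- truncation order of the zonal series -/
  K : ℕ
  /-- minorant mode (`1` crude series, `2` sharp series, else pole) -/
  mode : ℕ

/-- A `T`-cell `[T1, T2]` with its certificate (atoms + area atom `c`) and the checker parameters
(box range `[uMin, uMax]`, rounding precision `prec` bits, zonal table of `2^ns` entries, bisection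
fuel `depth`). [folklore] -/
structure Cell where
  /-- left end of the cell -/
  T1 : ℚ
  /-- right end of the cell -/
  T2 : ℚ
  /-- area atom -/
  c : ℚ
  /-- the atoms -/
  atoms : List Atom
  /-- lower end of the bisected `u`-range -/
  uMin : ℚ
  /-- upper end of the bisected `u`-range -/
  uMax : ℚ
  /-- fractional bits kept by the roundings -/
  prec : ℕ
  /-- `log₂` of the zonal table size -/
  ns : ℕ
  /-- bisection fuel -/
  depth : ℕ

/-- The real `τ = -log(q)/2` of an atom. [folklore] -/
noncomputable def Atom.tau (a : Atom) : ℝ := -(Real.log (a.q : ℝ)) / 2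

/-- The real value `w · zonal(τ, s) · e^{-(u-σ)²/(4τ)}` of an atom. [folklore] -/
noncomputable def Atom.val (a : Atom) (u s : ℝ) : ℝ :=
  (a.w : ℝ) * (zonal a.tau s * Real.exp (-(u - (a.σ : ℝ)) ^ 2 / (4 * a.tau)))

/-- The real value of a list of atoms. [folklore] -/
noncomputable def atomsVal : List Atom → ℝ → ℝ → ℝ
  | [], _, _ => 0
  | a :: as, u, s => a.val u s + atomsVal as u s

/-- The real right-hand side (certificate) of a cell: atoms plus the area atom. [folklore] -/
noncomputable def Cell.rhs (C : Cell) (u s : ℝ) : ℝ := atomsVal C.atoms u s + (C.c : ℝ)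

/-- The pulled-back Euclidean kernel, verbatim as in the registered stubs. [folklore] -/
noncomputable def pulledR (T u s : ℝ) : ℝ :=
  (8 * Real.pi ^ 2 / 3) * ((4 * Real.pi * T) ^ 2)⁻¹ * Real.exp (4 * u) *
    Real.exp (-(Real.exp (2 * u) - 2 * Real.exp u * s + 1) / (4 * T))

/-! ## The computable checker -/

/-- Clamp `x` to `[lo, hi]` (as `max lo (min x hi)`). [folklore] -/
def clampQ (x lo hi : ℚ) : ℚ := max lo (min x hi)

/-- Certified upper bound of `arccos(g)²` for `g ∈ [-1, 1]`: `6 - 2√(3 + 6g)` (with `√` rounded down)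
for `g ≥ -1/2`, else `987/100 > π²`. [folklore] -/
def theta2Hi (g : ℚ) (p : ℕ) : ℚ := if -1 / 2 ≤ g then 6 - 2 * sqrtLo (3 + 6 * g) p else 987 / 100

/-- The sharp-tail ratio condition `q^{K+3} (2K+7)(K+3)(K+4) < (2K+5)(K+2)(K+3)` of
`partialSum_sub_sharp_le_zonal`, as a Boolean. [folklore] -/
def sharpOK (q : ℚ) (K : ℕ) : Bool :=
  decide (q ^ (K + 3) * ((2 * (K : ℚ) + 7) * ((K : ℚ) + 3) * ((K : ℚ) + 4)) <
    (2 * (K : ℚ) + 5) * ((K : ℚ) + 2) * ((K : ℚ) + 3))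

/-- The sharp geometric tail `t_{K+1}/(1 - r)` of the zonal series at `τ = -(log q)/2`. [folklore] -/
def sharpTailQ (q : ℚ) (K : ℕ) : ℚ :=
  q ^ ((K + 1) * (K + 4) / 2) * ((2 * (K : ℚ) + 5) * ((K : ℚ) + 2) * ((K : ℚ) + 3) / 6) /
    (1 - q ^ (K + 3) * ((2 * (K : ℚ) + 7) * ((K : ℚ) + 3) * ((K : ℚ) + 4)) /
      ((2 * (K : ℚ) + 5) * ((K : ℚ) + 2) * ((K : ℚ) + 3)))

/-- The fast series lower bound with the SHARP tail: rounded partial sum minus `sharpTailQ`. [folklore] -/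
def zonalLoSharpR (q s : ℚ) (K p : ℕ) : ℚ := zonalPartialLoR q s K p - sharpTailQ q K

/-- Certified lower bound (clamped at `0`) of `zonal(τ_a, t)` for ALL `t ∈ [g, 1]`. [folklore] -/
def zonalLoAt (a : Atom) (g : ℚ) (p : ℕ) : ℚ :=
  max 0 (if a.mode = 1 then zonalLoSeriesR a.q g a.K p
    else if a.mode = 2 then zonalLoSharpR a.q g a.K p
    else rdn (zonalPoleLo a.q a.K * expLo (-(theta2Hi g p) / (4 * a.tlo)) p) p)

/-- The grid point `g_i = -1 + 2i/2^ns`. [folklore] -/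
def gridPt (ns i : ℕ) : ℚ := -1 + 2 * (i : ℚ) / 2 ^ ns

/-- The zonal table of an atom: entry `i` is a certified lower bound of `zonal(τ_a, ·)` on `[g_i, 1]`.
[folklore] -/
def zonalTable (C : Cell) (a : Atom) : Array ℚ :=
  (Array.range (2 ^ C.ns)).map fun i => zonalLoAt a (gridPt C.ns i) C.prec

/-- Table index for a box starting at `s1`: the largest `i` with `g_i ≤ s1` (clamped). [folklore] -/
def tableIdx (ns : ℕ) (s1 : ℚ) : ℕ := min (2 ^ ns - 1) ⌊(s1 + 1) * 2 ^ ns / 2⌋.toNat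

/-- Certified upper bound of `pulled(T, u, s)` over `T ∈ [T1, T2]`, `u ∈ [u1, u2]`, `s ≤ s2`
(`s, s2 ∈ [-1, 1]`): exact `T`-envelope at the certified lower bound `Qlo` of `Q`. [folklore] -/
def pulledHi (C : Cell) (u1 u2 s2 : ℚ) : ℚ :=
  let a := expLo u1 C.prec
  let b := expHi u2 C.prec
  let r := clampQ s2 a b
  let Qlo := (r - s2) ^ 2 + (1 - s2 ^ 2)
  let Tc := clampQ (Qlo / 8) C.T1 C.T2
  rup (1 / 6 * expHi (4 * u2) C.prec * expHi (-Qlo / (4 * Tc)) C.prec / Tc ^ 2) C.prec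

/-- Certified lower bound of one atom over the box `[u1, u2] × [s1, ·]`, given its table. [folklore] -/
def atomLo (C : Cell) (a : Atom) (tab : Array ℚ) (u1 u2 s1 : ℚ) : ℚ :=
  let d := max |u1 - a.σ| |u2 - a.σ|
  let z := tab.getD (tableIdx C.ns s1) 0
  if z ≤ 0 then 0 else a.w * z * expLo (-d ^ 2 / (4 * a.tlo)) C.prec

/-- Certified lower bound of a list of atoms (paired with their tables) over a box. [folklore] -/
def atomsLo (C : Cell) : List Atom → List (Array ℚ) → ℚ → ℚ → ℚ → ℚ
  | a :: as, t :: ts, u1, u2, s1 => atomLo C a t u1 u2 s1 + atomsLo C as ts u1 u2 s1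
  | _, _, _, _, _ => 0

/-- The leaf test of a box: upper bound of the kernel `≤` lower bound of the certificate. [folklore] -/
def leafOK (C : Cell) (tabs : List (Array ℚ)) (u1 u2 s1 s2 : ℚ) : Bool :=
  decide (pulledHi C u1 u2 s2 ≤ C.c + atomsLo C C.atoms tabs u1 u2 s1)

/-- Split heuristic (soundness does not depend on it): `true` = bisect in `u`. [folklore] -/
def splitU (C : Cell) (u1 u2 s1 s2 : ℚ) : Bool :=
  let b := expHi u2 8
  decide ((s2 - s1) * b ≤ (u2 - u1) * (8 * C.T1 + b * (b + 1)))

/-- Adaptive bisection of `[u1, u2] × [s1, s2]` with fuel. [folklore] -/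
def checkBox (C : Cell) (tabs : List (Array ℚ)) : ℕ → ℚ → ℚ → ℚ → ℚ → Bool
  | 0, _, _, _, _ => false
  | fuel + 1, u1, u2, s1, s2 =>
    leafOK C tabs u1 u2 s1 s2 ||
      (if splitU C u1 u2 s1 s2 then
        checkBox C tabs fuel u1 ((u1 + u2) / 2) s1 s2 && checkBox C tabs fuel ((u1 + u2) / 2) u2 s1 s2
      else
        checkBox C tabs fuel u1 u2 s1 ((s1 + s2) / 2) && checkBox C tabs fuel u1 u2 ((s1 + s2) / 2) s2)

/-- Atom validation: `0 < q < 1`, `0 ≤ w`, `0 < tlo` with `q ≤ expLo(-2 tlo)` (hence `tlo ≤ τ`), and in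
the series modes the tail-ratio condition (`32 q^{⌊(K+4)/2⌋} < 1` resp. `sharpOK`). [folklore] -/
def atomOK (C : Cell) (a : Atom) : Bool :=
  decide (0 < a.q) && decide (a.q < 1) && decide (0 ≤ a.w) && decide (0 < a.tlo) &&
    decide (a.q ≤ expLo (-2 * a.tlo) C.prec) &&
    (!decide (a.mode = 1) || decide (32 * a.q ^ ((a.K + 4) / 2) < 1)) &&
    (!decide (a.mode = 2) || sharpOK a.q a.K)

/-- Validation of a list of atoms. [folklore] -/
def atomsOK (C : Cell) : List Atom → Bool
  | [] => true
  | a :: as => atomOK C a && atomsOK C as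

/-- Sum of the weights of a list of atoms. [folklore] -/
def weightSum : List Atom → ℚ
  | [] => 0
  | a :: as => a.w + weightSum as

/-- The `u`-tails: below `uMin` the kernel is `≤ (6T₁²)⁻¹ e^{4 uMin} ≤ c`; above `uMax` it is decreasing
in `u` (`8T₂ ≤ e^U (e^U - 1)`) and `≤ c`. [folklore] -/
def tailsOK (C : Cell) : Bool :=
  let eU := expLo C.uMax C.prec
  decide (expHi (4 * C.uMin) C.prec / (6 * C.T1 ^ 2) ≤ C.c) &&
    decide (1 ≤ eU) && decide (8 * C.T2 ≤ eU * (eU - 1)) &&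
      decide (expHi (4 * C.uMax - (eU - 1) ^ 2 / (4 * C.T2)) C.prec / (6 * C.T1 ^ 2) ≤ C.c)

/-- The check of one cell against the mass bound `M`. [folklore] -/
def checkCell (C : Cell) (M : ℚ) : Bool :=
  decide (0 < C.T1) && decide (C.T1 ≤ C.T2) && decide (0 ≤ C.c) && decide (0 < C.ns) &&
    atomsOK C C.atoms && decide (weightSum C.atoms + C.c ≤ M) && tailsOK C &&
      checkBox C (C.atoms.map (zonalTable C)) C.depth C.uMin C.uMax (-1) 1

/-- The check of a contiguous cover of `[a, b]` by checked cells. [folklore] -/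
def checkCover : List Cell → ℚ → ℚ → ℚ → Bool
  | [], _, _, _ => false
  | [C], a, b, M => decide (C.T1 ≤ a) && decide (b ≤ C.T2) && checkCell C M
  | C :: C' :: rest, a, b, M =>
    decide (C.T1 ≤ a) && decide (C'.T1 ≤ C.T2) && checkCell C M && checkCover (C' :: rest) C'.T1 b M


/-! ## Two rational lemmas on the grid -/

/-- The grid points lie in `[-1, 1]`. [folklore] -/
theorem gridPt_mem (ns i : ℕ) (hi : i < 2 ^ ns) : -1 ≤ gridPt ns i ∧ gridPt ns i ≤ 1 := by
  unfold gridPt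
  have h2 : (0 : ℚ) < 2 ^ ns := by positivity
  have hi' : (i : ℚ) ≤ 2 ^ ns := by exact_mod_cast hi.le
  constructor
  · have : 0 ≤ 2 * (i : ℚ) / 2 ^ ns := by positivity
    linarith
  · rw [show (-1 : ℚ) + 2 * (i : ℚ) / 2 ^ ns = -1 + 2 * ((i : ℚ) / 2 ^ ns) by ring]
    have : (i : ℚ) / 2 ^ ns ≤ 1 := by rw [div_le_one h2]; exact hi'
    linarith

/-- The table index is in range and its grid point is `≤ s1` (for `s1 ≥ -1`). [folklore] -/
theorem tableIdx_spec (ns : ℕ) (s1 : ℚ) (hs1 : -1 ≤ s1) :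
    tableIdx ns s1 < 2 ^ ns ∧ gridPt ns (tableIdx ns s1) ≤ s1 := by
  have hpos : 0 < 2 ^ ns := Nat.two_pow_pos ns
  constructor
  · exact lt_of_le_of_lt (min_le_left _ _) (Nat.sub_lt hpos one_pos)
  · unfold gridPt
    have h2 : (0 : ℚ) < 2 ^ ns := by positivity
    set i := tableIdx ns s1 with hi
    have hle : (i : ℚ) ≤ (s1 + 1) * 2 ^ ns / 2 := by
      have h1 : i ≤ ⌊(s1 + 1) * 2 ^ ns / 2⌋.toNat := min_le_right _ _
      have hnn : 0 ≤ (s1 + 1) * 2 ^ ns / 2 := by nlinarith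
      have h3 : ((⌊(s1 + 1) * 2 ^ ns / 2⌋.toNat : ℤ) : ℚ) = ⌊(s1 + 1) * 2 ^ ns / 2⌋ := by
        rw [Int.toNat_of_nonneg (Int.floor_nonneg.2 hnn)]
      calc (i : ℚ) ≤ (⌊(s1 + 1) * 2 ^ ns / 2⌋.toNat : ℚ) := by exact_mod_cast h1
        _ = ((⌊(s1 + 1) * 2 ^ ns / 2⌋ : ℤ) : ℚ) := by exact_mod_cast h3
        _ ≤ (s1 + 1) * 2 ^ ns / 2 := Int.floor_le _
    have : 2 * (i : ℚ) / 2 ^ ns ≤ s1 + 1 := by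
      rw [div_le_iff₀ h2]; linarith
    linarith

end Cert

/-- Registered helper `helper_certGridPt` of crux stmt-SmoothPoincare4-7632: the zonal-table grid points of the
certificate checker lie in `[-1, 1]`. [folklore] -/
theorem helper_certGridPt : ∀ (ns i : ℕ), i < 2 ^ ns → -1 ≤ Cert.gridPt ns i ∧ Cert.gridPt ns i ≤ 1 :=
  Cert.gridPt_mem

end Summit.SmoothPoincare4.SmoothPoincare4.Theorems.CylinderEntropySliceIsolation
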